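import Summits.HodgeConjecture.CorCM.SimpleCMProductsDimLeThreeBlocks
import Summits.HodgeConjecture.CorCM.CMFamilyRankClosureBound
import Literature.AlgebraicGeometry.Pohlmann1968.CMFamilyRankPartition
import Literature.AlgebraicGeometry.HodgeTheory.HodgeConjectureIsogenyInvariance
import HarnessLib

/-!
# Products of ANY NUMBER of simple CM abelian varieties of dimension `≤ 3`: `Hg(∏ A_i) = ∏ Hg(A_i)` — and the Hodge
# conjecture on every `∏ A_i^{k_i}` — iff (i) no imaginary quadratic field embeds in two of the CM fields, (ii) no sextic CM
# field occurs more than three times, (iii) no Galois closure carries more than two of the surfaces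

COR-CM (cell `pub-hodgecm2`, binder seat `b16` gen 43, count-neutral claim CM-DIMLE3-PRODUCTS, file D4c — THE CAPSTONE; theorems
only, no definition, no named fact, no `sorry`).  NEW as stated, hence under `Summits/`.  HONEST FRAMING: an unconditional theorem on
products of CM abelian varieties of small dimension; not a step of the summit chain (HC_CM is not used and not advanced).

THE THEOREM (`isNondegenerateFamily_simpleFamily_dim_le_three_iff`).  Let `A_i` (`i ∈ I`, finite) be SIMPLE, PAIRWISE NON-ISOGENOUS
complex abelian varieties of CM type of dimension `≤ 3` — CM elliptic curves, simple CM surfaces, simple CM threefolds in any number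
and combination — realising CM types `Φ_i` of CM fields `K_i`.  Then the family `(Φ_i)_i` is nondegenerate — `Hg(∏_i A_i) =
∏_i Hg(A_i)` of rank `Σ_i dim A_i`; equivalently `B• = D•` on every `∏_i A_i^{k_i}` (Hazama–Murty) — IF AND ONLY IF

* (i) no totally complex quadratic subfield of one `K_i` embeds in another `K_j`;
* (ii) for every `i` with `[K_i : ℚ] = 6`, at most THREE of the `K_j` are isomorphic to `K_i`;
* (iii) for every `i` with `[K_i : ℚ] = 4`, at most TWO of the `K_j` have the same Galois closure in `ℂ` as `K_i`.

Hence `hodgeConjectureFor_prod_simpleFamily_dim_le_three` — **the Hodge conjecture, with all Hodge classes polynomials in divisor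
classes, on EVERY product `⨁_{j<N} A_{π j}` of such varieties satisfying (i)–(iii)** — UNCONDITIONALLY; and conversely
(`exists_exceptional_prod_simpleFamily_dim_le_three_iff`) an exceptional Hodge class on some power product as soon as one of
(i)–(iii) fails: a shared imaginary quadratic field (Weil classes), four isogeny classes of one sextic field (seat p2), three
surfaces in one dihedral closure (seat p2) are the ONLY sources of exceptional classes.

PROOF.  Blocks = Galois-closure classes (`isNondegenerateFamily_of_fibers` along `i ↦ L_i`): two slots of different closures
share no constituent under (i) (`CorCM/SimpleCMDistinctClosuresPairwise`); a block is a single curve (two quadratic fields with one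
closure coincide: (i)), at most two surfaces ((iii); `isNondegenerateFamily_quartic_block`), or threefolds with one closure
(`isNondegenerateFamily_sextic_block` under (i), (ii)) — degrees `2 ∣ 4 ∣ 8`, `6` do not mix.  Necessity: (i) seat b23; (ii) seat p2's
bound transported (`not_isNondegenerateFamily_of_ringEquiv_of_lt_card`); (iii) the closure bound `Σ_{block} [K_j:ℚ] ≤ [L:ℚ] ≤ 8`
(`sum_finrank_le_of_isNondegenerateFamily`); sub-families of nondegenerate families are nondegenerate (`isNondegenerateFamily_subtype`).

## References

* [MoonenZarhin1999LowDim] B. Moonen, Yu. Zarhin, *Hodge classes on abelian varieties of low dimension*, Math. Ann. 315 (1999),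
  Thm. (0.2), §3 (3.1), (3.9).
* [Gordon1999HodgeAVSurvey] B. B. Gordon, *A survey of the Hodge conjecture for abelian varieties*, §3, 7.4–7.7, 9.4, 10.10.
* [Dodson1984] B. Dodson, *The structure of Galois groups of CM-fields*, Trans. AMS 283 (1984), §5.1.2.
* [Shimura1998] G. Shimura, *Abelian Varieties with Complex Multiplication and Modular Functions*, §8.2 Prop. 26, §8.4.
-/

noncomputable section

open CategoryTheory CategoryTheory.Limits NumberField Module IntermediateField

namespace Summit.HodgeConjecture.CorCM

open Literature.NumberTheory.ComplexMultiplication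
open Literature.AlgebraicGeometry.Motives (AbelianVariety CMType)
open Literature.AlgebraicGeometry.HodgeTheory
open Literature.AlgebraicGeometry.ComplexMultiplication (IsCMTypeRealisation isSimple_iff_isPrimitive)
open Literature.AlgebraicGeometry.VanGeemen1994 (hodgeClassSpan)
open Literature.AlgebraicGeometry.Pohlmann1968
open Literature.Barriers.HodgeConjecture (divisorClassesSpan)

variable {I : Type} {K : I → Type} [∀ i, Field (K i)] [∀ i, NumberField (K i)] [∀ i, IsCMField (K i)] [Fintype I]
  [DecidableEq I] {Φ : ∀ i, CMType (K i)}

/-! ## §1 Sub-families of a nondegenerate family -/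

omit [DecidableEq I] in
/-- **A sub-family of a nondegenerate family is nondegenerate** (Hazama: abelian subvarieties of stably nondegenerate abelian
varieties; the block of a two-block partition, or the whole family re-indexed). [cite: Gordon1999HodgeAVSurvey, 7.6.1] -/
theorem isNondegenerateFamily_subtype (hΦ : CMAlgebra.IsNondegenerateFamily Φ) (p : I → Prop) [DecidablePred p]
    (hp : ∃ i, p i) : CMAlgebra.IsNondegenerateFamily (K := fun i : {i // p i} => K i.1) fun i => Φ i.1 := by
  classical
  obtain ⟨i₀, hi₀⟩ := hp
  haveI : Nonempty I := ⟨i₀⟩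
  by_cases hall : ∀ i, p i
  · exact (isNondegenerateFamily_iff_of_equiv Φ (Equiv.subtypeUnivEquiv hall)).2 hΦ
  · push Not at hall
    obtain ⟨i₁, hi₁⟩ := hall
    let κ : I → Bool := fun i => decide (p i)
    have hκ : Function.Surjective κ := fun b => by
      cases b
      · exact ⟨i₁, decide_eq_false hi₁⟩
      · exact ⟨i₀, decide_eq_true hi₀⟩
    have h := hΦ.fiber κ hκ true
    let e : {i // p i} ≃ {i // κ i = true} := Equiv.subtypeEquivRight fun i => by
      simp only [κ, decide_eq_true_eq]
    exact (isNondegenerateFamily_iff_of_equiv (K := fun i : {i // κ i = true} => K i.1) (fun i => Φ i.1) e).2 h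

/-! ## §2 Degrees inside one Galois-closure class -/

section Degrees

omit [∀ i, IsCMField (K i)] [Fintype I] [DecidableEq I] in
/-- The Galois closure of a quadratic field in `ℂ` has degree `2`. [folklore] -/
private theorem finrank_normalClosure_of_finrank_eq_two {i : I} (h2 : finrank ℚ (K i) = 2) :
    finrank ℚ ↥(normalClosure ℚ (K i) ℂ) = 2 := by
  haveI : Algebra.IsQuadraticExtension ℚ (K i) := ⟨h2⟩
  rw [finrank_normalClosure_of_normal, h2]

variable {A : I → AbelianVariety ℂ} {ι : ∀ i, 𝓞 (K i) →+* End (A i)}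
  {θ : ∀ i, K i →+* Module.End ℂ (complexBetti (A i).X 1)}

omit [∀ i, IsCMField (K i)] [Fintype I] [DecidableEq I] in
/-- The CM field of a realisation of dimension `≤ 3` has degree `2`, `4` or `6`. [cite: Shimura1998, §5.2] -/
private theorem finrank_eq_or_of_dim_le_three'' (hA : ∀ i, IsCMTypeRealisation (Φ i) (A i) (ι i) (θ i)) {i : I}
    (h3 : (A i).dim ≤ 3) : finrank ℚ (K i) = 2 ∨ finrank ℚ (K i) = 4 ∨ finrank ℚ (K i) = 6 := by
  have h := finrank_eq_two_mul_dim_of_isCMTypeRealisation (hA i)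
  have hpos : 0 < finrank ℚ (K i) := Module.finrank_pos
  interval_cases hd : (A i).dim <;> omega

omit [Fintype I] [DecidableEq I] in
/-- **Degrees do not mix inside a closure class**: two CM fields of degrees in `{2, 4, 6}` with the SAME Galois closure in
`ℂ` have the same degree (`[L:ℚ] = 2` for quadratic, `∈ {4, 8}` for quartic with a nondegenerate type, divisible by `6` for
sextic). [cite: Shimura1998, §8.4] -/
theorem finrank_eq_of_normalClosure_eq (hA : ∀ i, IsCMTypeRealisation (Φ i) (A i) (ι i) (θ i)) (h3 : ∀ i, (A i).dim ≤ 3)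
    {i j : I} (hL : normalClosure ℚ (K i) ℂ = normalClosure ℚ (K j) ℂ) : finrank ℚ (K i) = finrank ℚ (K j) := by
  have key : ∀ a b : I, normalClosure ℚ (K a) ℂ = normalClosure ℚ (K b) ℂ → finrank ℚ (K a) = 2 →
      finrank ℚ (K b) = 2 := by
    intro a b hab h2
    have h2L : finrank ℚ ↥(normalClosure ℚ (K b) ℂ) = 2 := by rw [← hab]; exact finrank_normalClosure_of_finrank_eq_two h2
    have hdvd := finrank_dvd_finrank_normalClosure (K := K) b
    rw [h2L] at hdvd
    rcases finrank_eq_or_of_dim_le_three'' hA (h3 b) with h | h | h <;> rw [h] at hdvd <;> omega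
  have key4 : ∀ a b : I, normalClosure ℚ (K a) ℂ = normalClosure ℚ (K b) ℂ → finrank ℚ (K a) = 4 →
      finrank ℚ (K b) ≠ 6 := fun a b hab h4 h6 =>
    not_normalClosure_le_of_sextic_of_quartic (K := K) h4 h6 (hab ▸ le_rfl)
  rcases finrank_eq_or_of_dim_le_three'' hA (h3 i) with hi | hi | hi <;>
    rcases finrank_eq_or_of_dim_le_three'' hA (h3 j) with hj | hj | hj
  · rw [hi, hj]
  · exact absurd (key i j hL hi) (by omega)
  · exact absurd (key i j hL hi) (by omega)
  · exact absurd (key j i hL.symm hj) (by omega)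
  · rw [hi, hj]
  · exact absurd hj (key4 i j hL hi)
  · exact absurd (key j i hL.symm hj) (by omega)
  · exact absurd hi (key4 j i hL.symm hj)
  · rw [hi, hj]

end Degrees

/-! ## §3 The census -/

section Census

variable [Nonempty I] {A : I → AbelianVariety ℂ} {ι : ∀ i, 𝓞 (K i) →+* End (A i)}
  {θ : ∀ i, K i →+* Module.End ℂ (complexBetti (A i).X 1)}

omit [Fintype I] [DecidableEq I] [Nonempty I] in
/-- A quadratic CM field mapping to `K_j` is a totally complex quadratic subfield of itself embedding in `K_j`. [cite: Shimura1998, §8.4] -/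
private theorem exists_quadratic_subfield_top' {i j : I} (h2 : finrank ℚ (K i) = 2) (g : K i →+* K j) :
    ∃ F : IntermediateField ℚ (K i), finrank ℚ F = 2 ∧ IsTotallyComplex F ∧ Nonempty (F →+* K j) := by
  refine ⟨⊤, by rw [IntermediateField.finrank_top', h2], ?_, ⟨g.comp (⊤ : IntermediateField ℚ (K i)).val.toRingHom⟩⟩
  letI : Algebra (K i) ↥(⊤ : IntermediateField ℚ (K i)) :=
    (IntermediateField.topEquiv (F := ℚ) (E := K i)).symm.toRingEquiv.toRingHom.toAlgebra
  exact isTotallyComplex_of_algebra (K i) _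

open scoped Classical in
/-- **THE CENSUS, sufficiency.**  Simple, pairwise non-isogenous CM abelian varieties of dimension `≤ 3` satisfying (i), (ii),
(iii): the family of their CM types is nondegenerate. [cite: MoonenZarhin1999LowDim, Thm. (0.2) and §3 (3.1)]
[cite: Gordon1999HodgeAVSurvey, §3 Theorem, 7.5 and 9.4] -/
theorem isNondegenerateFamily_simpleFamily_dim_le_three (hA : ∀ i, IsCMTypeRealisation (Φ i) (A i) (ι i) (θ i))
    (hS : ∀ i, (A i).IsSimple) (hniso : ∀ i j, i ≠ j → ¬ AbelianVariety.IsIsogenous (A i) (A j))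
    (h3 : ∀ i, (A i).dim ≤ 3)
    (hno : ∀ i j, i ≠ j →
      ¬ ∃ F : IntermediateField ℚ (K i), finrank ℚ F = 2 ∧ IsTotallyComplex F ∧ Nonempty (F →+* K j))
    (htri : ∀ i, finrank ℚ (K i) = 6 → (Finset.univ.filter fun j => Nonempty (K j ≃+* K i)).card ≤ 3)
    (hsurf : ∀ i, finrank ℚ (K i) = 4 →
      (Finset.univ.filter fun j => normalClosure ℚ (K j) ℂ = normalClosure ℚ (K i) ℂ).card ≤ 2) :
    CMAlgebra.IsNondegenerateFamily Φ := by
  refine isNondegenerateFamily_of_fibers Φ (fun i => normalClosure ℚ (K i) ℂ) (fun i j hij => ?_) (fun L hL => ?_)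
  · -- different closures
    have hne : i ≠ j := fun h => hij (h ▸ rfl)
    exact (pairwise_simple_dim_le_three_of_normalClosure_ne hA hS h3 hij (hno i j hne) (hno j i hne.symm)).1
  · -- one closure class
    obtain ⟨i₀, hi₀⟩ := hL
    haveI : Nonempty {i // normalClosure ℚ (K i) ℂ = L} := ⟨⟨i₀, hi₀⟩⟩
    have hcl : ∀ i j : {i // normalClosure ℚ (K i) ℂ = L}, normalClosure ℚ (K i.1) ℂ = normalClosure ℚ (K j.1) ℂ :=
      fun i j => i.2.trans j.2.symm
    have hdeg : ∀ j : {i // normalClosure ℚ (K i) ℂ = L}, finrank ℚ (K j.1) = finrank ℚ (K i₀) := fun j =>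
      finrank_eq_of_normalClosure_eq hA h3 (j.2.trans hi₀.symm)
    have hA' : ∀ j : {i // normalClosure ℚ (K i) ℂ = L}, IsCMTypeRealisation (Φ j.1) (A j.1) (ι j.1) (θ j.1) :=
      fun j => hA j.1
    have hniso' : ∀ a b : {i // normalClosure ℚ (K i) ℂ = L}, a ≠ b → ¬ AbelianVariety.IsIsogenous (A a.1) (A b.1) :=
      fun a b hab => hniso a.1 b.1 fun h => hab (Subtype.ext h)
    rcases finrank_eq_or_of_dim_le_three'' hA (h3 i₀) with h₀ | h₀ | h₀
    · -- curves: a single member (two quadratic fields with one closure coincide)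
      haveI : Subsingleton {i // normalClosure ℚ (K i) ℂ = L} := ⟨fun a b => by
        by_contra hab
        have h2a : finrank ℚ (K a.1) = 2 := (hdeg a).trans h₀
        have h2b : finrank ℚ (K b.1) = 2 := (hdeg b).trans h₀
        obtain ⟨xa⟩ : Nonempty (K a.1 →+* ℂ) := inferInstance
        obtain ⟨xb⟩ : Nonempty (K b.1 →+* ℂ) := inferInstance
        haveI : FiniteDimensional ℚ ↥xa.toRatAlgHom.fieldRange :=
          LinearEquiv.finiteDimensional (AlgEquiv.ofInjectiveField xa.toRatAlgHom).toLinearEquiv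
        haveI : FiniteDimensional ℚ ↥xb.toRatAlgHom.fieldRange :=
          LinearEquiv.finiteDimensional (AlgEquiv.ofInjectiveField xb.toRatAlgHom).toLinearEquiv
        -- both images are the common closure
        have hra : xa.toRatAlgHom.fieldRange = normalClosure ℚ (K a.1) ℂ :=
          IntermediateField.eq_of_le_of_finrank_eq xa.toRatAlgHom.fieldRange_le_normalClosure
            (((AlgEquiv.ofInjectiveField xa.toRatAlgHom).toLinearEquiv.finrank_eq).symm.trans
              (h2a.trans (finrank_normalClosure_of_finrank_eq_two h2a).symm))
        have hrb : xb.toRatAlgHom.fieldRange = normalClosure ℚ (K b.1) ℂ :=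
          IntermediateField.eq_of_le_of_finrank_eq xb.toRatAlgHom.fieldRange_le_normalClosure
            (((AlgEquiv.ofInjectiveField xb.toRatAlgHom).toLinearEquiv.finrank_eq).symm.trans
              (h2b.trans (finrank_normalClosure_of_finrank_eq_two h2b).symm))
        have hab' : xa.toRatAlgHom.fieldRange = xb.toRatAlgHom.fieldRange := by rw [hra, hrb, hcl a b]
        have g : K a.1 →+* K b.1 :=
          ((AlgEquiv.ofInjectiveField xa.toRatAlgHom).trans
            ((IntermediateField.equivOfEq hab').trans (AlgEquiv.ofInjectiveField xb.toRatAlgHom).symm)).toRingEquiv.toRingHom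
        exact hno a.1 b.1 (fun h => hab (Subtype.ext h)) (exists_quadratic_subfield_top' h2a g)⟩
      exact isNondegenerateFamily_of_subsingleton _ fun j =>
        isNondegenerate_of_isSimple_of_dim_le_three_slot hA (hS j.1) (h3 j.1)
    · -- surfaces: at most two by (iii)
      have h4 : ∀ j : {i // normalClosure ℚ (K i) ℂ = L}, finrank ℚ (K j.1) = 4 := fun j => (hdeg j).trans h₀
      refine isNondegenerateFamily_quartic_block hA' (fun j => hS j.1) hniso' h4 ?_
      calc Fintype.card {i // normalClosure ℚ (K i) ℂ = L}
          ≤ (Finset.univ.filter fun j => normalClosure ℚ (K j) ℂ = normalClosure ℚ (K i₀) ℂ).card := by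
            rw [Fintype.card_subtype]
            exact Finset.card_le_card fun j hj => by
              simp only [Finset.mem_filter, Finset.mem_univ, true_and] at hj ⊢
              rw [hj, hi₀]
        _ ≤ 2 := hsurf i₀ h₀
    · -- threefolds: the sextic block under (i), (ii)
      have h6 : ∀ j : {i // normalClosure ℚ (K i) ℂ = L}, finrank ℚ (K j.1) = 6 := fun j => (hdeg j).trans h₀
      refine isNondegenerateFamily_sextic_block hA' (fun j => hS j.1) hniso' h6 hcl
        (fun a b hab => hno a.1 b.1 fun h => hab (Subtype.ext h)) fun a => ?_
      calc (Finset.univ.filter fun j : {i // normalClosure ℚ (K i) ℂ = L} => Nonempty (K j.1 ≃+* K a.1)).card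
          ≤ (Finset.univ.filter fun j : I => Nonempty (K j ≃+* K a.1)).card := by
            refine Finset.card_le_card_of_injOn (fun j => j.1) (fun j hj => ?_) (fun x _ y _ h => Subtype.ext h)
            simp only [Finset.coe_filter, Finset.mem_univ, true_and, Set.mem_setOf_eq] at hj ⊢
            exact hj
        _ ≤ 3 := htri a.1 (h6 a)

open scoped Classical in
/-- **THE CENSUS.**  For simple, pairwise non-isogenous CM abelian varieties of dimension `≤ 3`, the family of their CM types is
nondegenerate — `Hg(∏_i A_i) = ∏_i Hg(A_i)`, every power product `∏_i A_i^{k_i}` has `B• = D•` — IF AND ONLY IF (i) no totally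
complex quadratic subfield of one field embeds in another, (ii) no sextic field occurs more than three times up to isomorphism,
and (iii) no Galois closure is shared by more than two of the quartic fields. [cite: MoonenZarhin1999LowDim, Thm. (0.2) and §3]
[cite: Gordon1999HodgeAVSurvey, §3 Theorem, 7.4–7.7 and 9.4] [cite: Dodson1984, §5.1.2 Theorem] -/
theorem isNondegenerateFamily_simpleFamily_dim_le_three_iff (hA : ∀ i, IsCMTypeRealisation (Φ i) (A i) (ι i) (θ i))
    (hS : ∀ i, (A i).IsSimple) (hniso : ∀ i j, i ≠ j → ¬ AbelianVariety.IsIsogenous (A i) (A j))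
    (h3 : ∀ i, (A i).dim ≤ 3) :
    CMAlgebra.IsNondegenerateFamily Φ ↔
      (∀ i j, i ≠ j →
        ¬ ∃ F : IntermediateField ℚ (K i), finrank ℚ F = 2 ∧ IsTotallyComplex F ∧ Nonempty (F →+* K j)) ∧
      (∀ i, finrank ℚ (K i) = 6 → (Finset.univ.filter fun j => Nonempty (K j ≃+* K i)).card ≤ 3) ∧
      (∀ i, finrank ℚ (K i) = 4 →
        (Finset.univ.filter fun j => normalClosure ℚ (K j) ℂ = normalClosure ℚ (K i) ℂ).card ≤ 2) := by
  classical
  refine ⟨fun hnd => ⟨?_, ?_, ?_⟩, fun h => isNondegenerateFamily_simpleFamily_dim_le_three hA hS hniso h3 h.1 h.2.1 h.2.2⟩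
  · rintro i j hij ⟨F, hF2, hFtc, ⟨g⟩⟩
    haveI := hFtc
    exact not_isNondegenerateFamily_of_shared_imaginary_quadratic (k := ↥F) hF2 hij (algebraMap (↥F) (K i)) g Φ hnd
  · -- (ii): more than three isomorphic sextic fields would give a degenerate sub-family
    intro i h6
    by_contra hlt
    have hsub := isNondegenerateFamily_subtype hnd (fun j => Nonempty (K j ≃+* K i)) ⟨i, ⟨RingEquiv.refl _⟩⟩
    haveI : Nonempty {j // Nonempty (K j ≃+* K i)} := ⟨⟨i, ⟨RingEquiv.refl _⟩⟩⟩
    refine not_isNondegenerateFamily_of_ringEquiv_of_lt_card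
      (K := fun j : {j // Nonempty (K j ≃+* K i)} => K j.1) (fun j => Classical.choice j.2) (fun j => Φ j.1) ?_ hsub
    rw [h6, Fintype.card_subtype]
    omega
  · -- (iii): the members of the closure class of a quartic field are quartic, and `4 · #class ≤ [L:ℚ] ≤ 8`
    intro i h4
    by_contra hlt
    have hsub := isNondegenerateFamily_subtype hnd (fun j => normalClosure ℚ (K j) ℂ = normalClosure ℚ (K i) ℂ) ⟨i, rfl⟩
    haveI : Nonempty {j // normalClosure ℚ (K j) ℂ = normalClosure ℚ (K i) ℂ} := ⟨⟨i, rfl⟩⟩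
    have hsum := sum_finrank_le_of_isNondegenerateFamily (K := fun j : {j // normalClosure ℚ (K j) ℂ =
        normalClosure ℚ (K i) ℂ} => K j.1) (normalClosure ℚ (K i) ℂ) (fun j s y => by
          have h := apply_mem_normalClosure j.1 s y
          rw [j.2] at h
          exact h) hsub
    have h4' : ∀ j : {j // normalClosure ℚ (K j) ℂ = normalClosure ℚ (K i) ℂ}, finrank ℚ (K j.1) = 4 := fun j =>
      (finrank_eq_of_normalClosure_eq hA h3 j.2).trans h4
    simp only [h4', Finset.sum_const, Finset.card_univ, smul_eq_mul] at hsum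
    rw [Fintype.card_subtype] at hsum
    rcases finrank_normalClosure_quartic (K := K) h4 with h | h <;> rw [h] at hsum <;> omega

open scoped Classical in
/-- **The Hodge conjecture on every product `⨁_{j<N} A_{π j}`** (every `∏_i A_i^{k_i}`) of simple, pairwise non-isogenous CM abelian
varieties of dimension `≤ 3` satisfying (i), (ii), (iii) — UNCONDITIONALLY, with all Hodge classes polynomials in divisor classes.
[cite: MoonenZarhin1999LowDim, Thm. (0.2)] [cite: Gordon1999HodgeAVSurvey, 7.5 and 10.10] -/
theorem hodgeConjectureFor_prod_simpleFamily_dim_le_three (hA : ∀ i, IsCMTypeRealisation (Φ i) (A i) (ι i) (θ i))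
    (hS : ∀ i, (A i).IsSimple) (hniso : ∀ i j, i ≠ j → ¬ AbelianVariety.IsIsogenous (A i) (A j))
    (h3 : ∀ i, (A i).dim ≤ 3)
    (hno : ∀ i j, i ≠ j →
      ¬ ∃ F : IntermediateField ℚ (K i), finrank ℚ F = 2 ∧ IsTotallyComplex F ∧ Nonempty (F →+* K j))
    (htri : ∀ i, finrank ℚ (K i) = 6 → (Finset.univ.filter fun j => Nonempty (K j ≃+* K i)).card ≤ 3)
    (hsurf : ∀ i, finrank ℚ (K i) = 4 →
      (Finset.univ.filter fun j => normalClosure ℚ (K j) ℂ = normalClosure ℚ (K i) ℂ).card ≤ 2)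
    {N : ℕ} (π : Fin N → I) :
    HodgeConjectureFor (⨁ fun j : Fin N => A (π j)).dim (⨁ fun j : Fin N => A (π j)).X ∧
      ∀ m, hodgeClassSpan (⨁ fun j : Fin N => A (π j)).dim (⨁ fun j : Fin N => A (π j)).X m =
        divisorClassesSpan (⨁ fun j : Fin N => A (π j)).X (⨁ fun j : Fin N => A (π j)).dim m := by
  classical
  have hnd := isNondegenerateFamily_simpleFamily_dim_le_three hA hS hniso h3 hno htri hsurf
  exact ⟨hnd.hodgeConjectureFor_prod hA π, fun m => hnd.hodgeClassSpan_prod_eq_divisorClassesSpan hA π m⟩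

open scoped Classical in
/-- **Exceptional classes iff one of (i)–(iii) fails**: for simple, pairwise non-isogenous CM abelian varieties of dimension `≤ 3`,
some power product `⨁_{j<N} A_{π j}` carries a rational `(m,m)`-class outside `Dᵐ ⊗ ℂ` iff NOT [(i) ∧ (ii) ∧ (iii)] — shared imaginary
quadratic fields, four isogeny classes of one sextic field, and three surfaces in one dihedral closure are the only sources of
exceptional Hodge classes in dimension `≤ 3` per factor. [cite: Gordon1999HodgeAVSurvey, 7.5 and 9.4] [cite: MoonenZarhin1999LowDim, Thm. (0.2)] -/
theorem exists_exceptional_prod_simpleFamily_dim_le_three_iff (hA : ∀ i, IsCMTypeRealisation (Φ i) (A i) (ι i) (θ i))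
    (hS : ∀ i, (A i).IsSimple) (hniso : ∀ i j, i ≠ j → ¬ AbelianVariety.IsIsogenous (A i) (A j))
    (h3 : ∀ i, (A i).dim ≤ 3) :
    (∃ (N : ℕ) (π : Fin N → I) (m : ℕ) (c : complexBetti (⨁ fun j : Fin N => A (π j)).X (2 * m)),
      IsRationalClass c ∧
      IsOfHodgeType (⨁ fun j : Fin N => A (π j)).dim (⨁ fun j : Fin N => A (π j)).X (2 * m) m m c ∧
      c ∉ divisorClassesSpan (⨁ fun j : Fin N => A (π j)).X (⨁ fun j : Fin N => A (π j)).dim m) ↔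
    ¬ ((∀ i j, i ≠ j →
        ¬ ∃ F : IntermediateField ℚ (K i), finrank ℚ F = 2 ∧ IsTotallyComplex F ∧ Nonempty (F →+* K j)) ∧
      (∀ i, finrank ℚ (K i) = 6 → (Finset.univ.filter fun j => Nonempty (K j ≃+* K i)).card ≤ 3) ∧
      (∀ i, finrank ℚ (K i) = 4 →
        (Finset.univ.filter fun j => normalClosure ℚ (K j) ℂ = normalClosure ℚ (K i) ℂ).card ≤ 2)) := by
  rw [← isNondegenerateFamily_simpleFamily_dim_le_three_iff hA hS hniso h3]
  constructor
  · rintro ⟨N, π, m, c, hcQ, hcH, hcD⟩ hnd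
    exact hnd.not_exists_exceptional_prod hA π m ⟨c, hcQ, hcH, hcD⟩
  · intro hnd
    exact CMAlgebra.exists_exceptional_prod_of_not_isNondegenerateFamily
      (CMAlgebra.isSeparatingFamily_of_isSimple_of_pairwise_not_isIsogenous hA hS hniso) hnd hA

open scoped Classical in
/-- **The Hodge conjecture for every complex abelian variety ISOGENOUS to a product `⨁_{j<N} A_{π j}`** of simple, pairwise
non-isogenous CM abelian varieties of dimension `≤ 3` satisfying (i), (ii), (iii) — so for a CM abelian variety all of whose simple
isogeny factors have dimension `≤ 3`, the Hodge conjecture holds as soon as its factors, listed once each up to isogeny, satisfy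
(i)–(iii) (van Geemen's Lemma 3.7: the Hodge conjecture is an isogeny invariant).
[cite: vanGeemen1994HodgeAV, §3.6–3.7 Lemma 3.7] [cite: MoonenZarhin1999LowDim, Thm. (0.2)] -/
theorem hodgeConjectureFor_of_isIsogenous_prod_simpleFamily_dim_le_three
    (hA : ∀ i, IsCMTypeRealisation (Φ i) (A i) (ι i) (θ i))
    (hS : ∀ i, (A i).IsSimple) (hniso : ∀ i j, i ≠ j → ¬ AbelianVariety.IsIsogenous (A i) (A j))
    (h3 : ∀ i, (A i).dim ≤ 3)
    (hno : ∀ i j, i ≠ j →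
      ¬ ∃ F : IntermediateField ℚ (K i), finrank ℚ F = 2 ∧ IsTotallyComplex F ∧ Nonempty (F →+* K j))
    (htri : ∀ i, finrank ℚ (K i) = 6 → (Finset.univ.filter fun j => Nonempty (K j ≃+* K i)).card ≤ 3)
    (hsurf : ∀ i, finrank ℚ (K i) = 4 →
      (Finset.univ.filter fun j => normalClosure ℚ (K j) ℂ = normalClosure ℚ (K i) ℂ).card ≤ 2)
    {N : ℕ} (π : Fin N → I) {B : AbelianVariety ℂ} (hB : AbelianVariety.IsIsogenous B (⨁ fun j : Fin N => A (π j))) :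
    HodgeConjectureFor B.dim B.X :=
  HodgeConjectureFor.of_isIsogenous hB (hodgeConjectureFor_prod_simpleFamily_dim_le_three hA hS hniso h3 hno htri hsurf π).1

end Census

end Summit.HodgeConjecture.CorCM

end
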